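import Summits.CriticalPhenomena.PercolationContinuityZ3.Theorems.PercNearOneGluingNoHeavyLowerTailThreePointVarianceRefutationGraph
import Summits.CriticalPhenomena.PercolationContinuityZ3.Theorems.PercNearOneGluingNoHeavyLowerTailThreePointVarianceRefutationChains
import HarnessLib

/-!
# The three-point variance row `(3PT)` is FALSE: `2⁶⁴` parallel copies of the hub chain `G₄(1/150,1/150)`

Support file for crux `stmt-CriticalPhenomena-4575` (`NoHeavyLowerTail`, closed), seat `prim-nh-lead-4575` gen 114
(`--supports stmt-CriticalPhenomena-4575`).  KERNEL REFUTATION of the row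

  `(3PT)   P(a↔b)·P(a↮b) ≤ P(a↔b, a↮c) + P(a↔c, a↮b) + P(b↔c, a↮b)`   for every finite weighted graph and distinct `a b c`

(conjectured for all `n`; kernel theorems for `n ≤ 5`, hub graphs, parallel compositions of `(K)`-pieces — all of which stand), following
prim-l12-p6 gen 22's counterexample family `(G ∥ σG)^{∥k}` (memo `run/shared/lean/prim/prim-l12/FROM-prim-l12-p6-g22-3PT-REFUTED.md`; the
lead's second engine `HOME/lab-gen114/cex3pt/` confirms it exactly).  THE GRAPH: vertex type `VV = Fin 3 ⊕ (Fin 2⁶⁴ × Fin 4)` — terminals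
`a b c` and, for each of `K = 2⁶⁴` copies, four hubs carrying a copy of the gadget `G₄(1/150,1/150)` of `…RefutationGadget` (pairs `c–hᵢ`
of weight `149/150`, chain `a–h₁–h₂–h₃–h₄–b` of weight `1/150`); pairs between different copies have weight `0` (a parallel composition at
`a, b, c`; the gadget is `a ↔ b`-symmetric, so no mirror copies are needed).  PROOF: by prim-l12-p1 gen 20's piece calculus
(`ThreePointPieces.real_isoPa/b/c`, `real_sepP'`, `real_isoP`, `real_sepP`) the four isolation probabilities are `K`-th powers of the
gadget's, each piece factor being transported to the gadget on `Fin 7` (`isoPiece_chart`, `prodBernoulli_real_preimage_comapConf`) and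
evaluated there by `decide +kernel` (`mass_Q/A/B/C`): `P(a|b|c) = Q₀^K`, `P(c iso) = A₀^K`, `P(b iso) = P(a iso) = B₀^K`.  With the EXACT
cells `{a↔b, a↮c} = {c iso} ∖ {a|b|c}` etc., `(3PT)` for this graph reads `2Q₀^K − A₀^K ≤ (2B₀^K − Q₀^K)²`, and it FAILS because
`(A₀/Q₀)^K + 4(B₀²/Q₀)^K < 2` (`…RefutationChains`: `1.62622… + 0.36204 < 2`).  Everything concrete is kept free of `Finset`-membership
statements over `VV` (whose normal forms would unfold `Finset.univ` of `2⁶⁴+…` elements): the piece identification is the generic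
`…RefutationPieceMap`.  Main results: `threePointVariance_fails` (the instance) and `not_threePointVariance_all`.
No named facts, no sorries, standard axioms.
-/

namespace Summit.CriticalPhenomena.PercolationContinuityZ3.Theorems.ThreePointVarianceRefutation

open MeasureTheory Set Literature.Probability.Percolation Literature.Probability.LatticeModels
open Summit.CriticalPhenomena.PercolationContinuityZ3.Theorems.ThreePointPieces
open Summit.CriticalPhenomena.PercolationContinuityZ3.Theorems.ThreePointHubEvents (tClosed real_tClosed real_tClosed_inter)

/-! ## The gadget events `E0 T7` as listed-pair predicates -/

/-- Every listed pair of the gadget is a non-terminal pair. [this work] -/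
theorem edge_mem_ntpSet (i : Fin 9) : gad.edge i ∈ ntpSet T7 := by
  rw [show gad.edge i = s(gad.src i, gad.dst i) from rfl, mk_mem_ntpSet]
  revert i; decide

/-- The configuration of the listed pairs indexed by `t` lies inside the non-terminal pairs. [this work] -/
theorem conf_subset_ntpSet (t : Finset (Fin 9)) : (gad.conf t : Set (Sym2 (Fin 7))) ⊆ ntpSet T7 := by
  intro e he
  unfold FK.RCEval.conf at he
  rw [Finset.mem_coe, Finset.mem_image] at he
  obtain ⟨i, -, rfl⟩ := he
  exact edge_mem_ntpSet i

/-- Configurations of listed pairs are unchanged by intersecting with the non-terminal pairs. [this work] -/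
theorem conf_inter_ntpSet (t : Finset (Fin 9)) : (gad.conf t : Set (Sym2 (Fin 7))) ∩ ntpSet T7 = gad.conf t :=
  Set.inter_eq_left.2 (conf_subset_ntpSet t)

/-- `reachB` reads open reachability (restated on `Fin 7`). [this work] -/
theorem reachB_iff7 (t : Finset (Fin 9)) (u v : Fin 7) :
    gad.reachB t u v = true ↔ (openGraph (gad.conf t : Set (Sym2 (Fin 7)))).Reachable u v :=
  FK.RCEval.reachB_iff (D := gad) t u v

/-- Membership of a listed configuration in `E0 T7`, read by `reachB`. [this work] -/
theorem conf_mem_E0 (t : Finset (Fin 9)) (p q r : Fin 7) :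
    gad.conf t ∈ E0 T7 p q r ↔ (gad.reachB t p q = false ∧ gad.reachB t p r = false) := by
  show (¬ (openGraph ((gad.conf t : Set (Sym2 (Fin 7))) ∩ ntpSet T7)).Reachable p q ∧
      ¬ (openGraph ((gad.conf t : Set (Sym2 (Fin 7))) ∩ ntpSet T7)).Reachable p r) ↔ _
  rw [conf_inter_ntpSet, ← reachB_iff7, ← reachB_iff7, Bool.not_eq_true, Bool.not_eq_true]

/-- `reachB` is symmetric. [this work] -/
theorem reachB_comm (t : Finset (Fin 9)) (p q : Fin 7) : gad.reachB t p q = gad.reachB t q p := by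
  rw [Bool.eq_iff_iff, reachB_iff7, reachB_iff7]
  exact SimpleGraph.reachable_comm

/-- `P(a isolated inside one piece) = C₀ = B₀`. [this work] -/
theorem real_E0_a : (prodBernoulli gad.w).real (E0 T7 0 1 2) = ((38188767591059602649 / 38443359375000000000 : ℚ) : ℝ) := by
  rw [← mass_C]
  refine real_eq_massW fun t => ?_
  rw [conf_mem_E0]; simp [pC]
/-- `P(b isolated inside one piece) = B₀`. [this work] -/
theorem real_E0_b : (prodBernoulli gad.w).real (E0 T7 1 0 2) = ((38188767591059602649 / 38443359375000000000 : ℚ) : ℝ) := by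
  rw [← mass_B]
  refine real_eq_massW fun t => ?_
  rw [conf_mem_E0]; simp [pB]
/-- `P(c isolated inside one piece) = A₀`. [this work] -/
theorem real_E0_c : (prodBernoulli gad.w).real (E0 T7 2 0 1) = ((18967930922711723173 / 19221679687500000000 : ℚ) : ℝ) := by
  rw [← mass_A]
  refine real_eq_massW fun t => ?_
  rw [conf_mem_E0]; simp [pA]
/-- `P(a|b|c inside one piece) = Q₀`. [this work] -/
theorem real_E0_sep : (prodBernoulli gad.w).real (E0 T7 0 1 2 ∩ E0 T7 1 0 2) =
    ((7587172369084689269 / 7688671875000000000 : ℚ) : ℝ) := by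
  rw [← mass_Q]
  refine real_eq_massW fun t => ?_
  rw [Set.mem_inter_iff, conf_mem_E0, conf_mem_E0, reachB_comm t 1 0]
  simp only [pQ]
  generalize gad.reachB t 0 1 = x
  generalize gad.reachB t 0 2 = y
  generalize gad.reachB t 1 2 = z
  cases x <;> cases y <;> cases z <;> simp

/-! ## The piece factors of the big graph -/

/-- **The probability of a pulled-back gadget event is its gadget probability** (transport along the chart of copy `j`). [this work] -/
theorem real_preimage_emb (j : Cp) (E : Set (Set (Sym2 (Fin 7)))) :
    (prodBernoulli wt).real (comapConf (Sym2.map (emb j)) ⁻¹' E) = (prodBernoulli gad.w).real E := by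
  rw [prodBernoulli_real_preimage_comapConf wt (Sym2.map.injective (emb_injective j)) MeasurableSet.of_discrete, wt_comp_emb]

/-- `isoPiece` of piece `j` for `a`, as a pull-back. [this work] -/
theorem isoPiece_a (j : Cp) : isoPiece (piecePairs ta tb tc part j) ta tb tc = comapConf (Sym2.map (emb j)) ⁻¹' E0 T7 0 1 2 := by
  have h := isoPiece_chart chart j 0 1 2
  rwa [emb_zero, emb_one, emb_two] at h
/-- `isoPiece` of piece `j` for `b`, as a pull-back. [this work] -/
theorem isoPiece_b (j : Cp) : isoPiece (piecePairs ta tb tc part j) tb ta tc = comapConf (Sym2.map (emb j)) ⁻¹' E0 T7 1 0 2 := by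
  have h := isoPiece_chart chart j 1 0 2
  rwa [emb_zero, emb_one, emb_two] at h
/-- `isoPiece` of piece `j` for `c`, as a pull-back. [this work] -/
theorem isoPiece_c (j : Cp) : isoPiece (piecePairs ta tb tc part j) tc ta tb = comapConf (Sym2.map (emb j)) ⁻¹' E0 T7 2 0 1 := by
  have h := isoPiece_chart chart j 2 0 1
  rwa [emb_zero, emb_one, emb_two] at h

/-- The piece factor `C_j = B₀`. [this work] -/
theorem piece_a (j : Cp) : (prodBernoulli wt).real (isoPiece (piecePairs ta tb tc part j) ta tb tc) =
    ((38188767591059602649 / 38443359375000000000 : ℚ) : ℝ) := by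
  rw [isoPiece_a, real_preimage_emb, real_E0_a]
/-- The piece factor `B_j = B₀`. [this work] -/
theorem piece_b (j : Cp) : (prodBernoulli wt).real (isoPiece (piecePairs ta tb tc part j) tb ta tc) =
    ((38188767591059602649 / 38443359375000000000 : ℚ) : ℝ) := by
  rw [isoPiece_b, real_preimage_emb, real_E0_b]
/-- The piece factor `A_j = A₀`. [this work] -/
theorem piece_c (j : Cp) : (prodBernoulli wt).real (isoPiece (piecePairs ta tb tc part j) tc ta tb) =
    ((18967930922711723173 / 19221679687500000000 : ℚ) : ℝ) := by
  rw [isoPiece_c, real_preimage_emb, real_E0_c]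
/-- The piece factor `Q_j = Q₀`. [this work] -/
theorem piece_sep (j : Cp) : (prodBernoulli wt).real
    (isoPiece (piecePairs ta tb tc part j) ta tb tc ∩ isoPiece (piecePairs ta tb tc part j) tb ta tc) =
    ((7587172369084689269 / 7688671875000000000 : ℚ) : ℝ) := by
  rw [isoPiece_a, isoPiece_b, ← Set.preimage_inter, real_preimage_emb, real_E0_sep]

/-! ## The four isolation probabilities and the exact cells -/

/-- `Q₀`. [this work] -/
def cQ : ℚ := 7587172369084689269 / 7688671875000000000
/-- `A₀`. [this work] -/
def cA : ℚ := 18967930922711723173 / 19221679687500000000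
/-- `B₀ = C₀`. [this work] -/
def cB : ℚ := 38188767591059602649 / 38443359375000000000

/-- The null event of the parallel composition. [this work] -/
theorem badP_null : (prodBernoulli wt).real (badP ta tb tc part) = 0 := real_badP wt ta tb tc part wt_cross

/-- **`P(a isolated) = B₀^K`.** [this work] -/
theorem real_IA : (prodBernoulli wt).real ((openConn ta tb)ᶜ ∩ (openConn ta tc)ᶜ) = (cB : ℝ) ^ (2 ^ 64) := by
  rw [real_isoPa wt part ta_ne_tb ta_ne_tc badP_null,
    real_isoP wt ta tb tc part (mem_terms.2 (Or.inl rfl)) (mem_terms.2 (Or.inr (Or.inl rfl))) (mem_terms.2 (Or.inr (Or.inr rfl))),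
    real_tClosed wt tb_ne_tc, wt_ab, wt_ac]
  have hf : (fun i : Cp => (prodBernoulli wt).real (isoPiece (piecePairs ta tb tc part i) ta tb tc)) = fun _ => (cB : ℝ) :=
    funext fun i => piece_a i
  rw [hf, Finset.prod_const, Finset.card_univ, card_Cp]
  ring

/-- **`P(b isolated) = B₀^K`.** [this work] -/
theorem real_IB : (prodBernoulli wt).real ((openConn ta tb)ᶜ ∩ (openConn tb tc)ᶜ) = (cB : ℝ) ^ (2 ^ 64) := by
  rw [real_isoPb wt part ta_ne_tb tb_ne_tc badP_null,
    real_isoP wt ta tb tc part (mem_terms.2 (Or.inr (Or.inl rfl))) (mem_terms.2 (Or.inl rfl)) (mem_terms.2 (Or.inr (Or.inr rfl))),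
    real_tClosed wt ta_ne_tc, Sym2.eq_swap (a := tb) (b := ta), wt_ab, wt_bc]
  have hf : (fun i : Cp => (prodBernoulli wt).real (isoPiece (piecePairs ta tb tc part i) tb ta tc)) = fun _ => (cB : ℝ) :=
    funext fun i => piece_b i
  rw [hf, Finset.prod_const, Finset.card_univ, card_Cp]
  ring

/-- **`P(c isolated) = A₀^K`.** [this work] -/
theorem real_IC : (prodBernoulli wt).real ((openConn ta tc)ᶜ ∩ (openConn tb tc)ᶜ) = (cA : ℝ) ^ (2 ^ 64) := by
  rw [real_isoPc wt part ta_ne_tc tb_ne_tc badP_null,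
    real_isoP wt ta tb tc part (mem_terms.2 (Or.inr (Or.inr rfl))) (mem_terms.2 (Or.inl rfl)) (mem_terms.2 (Or.inr (Or.inl rfl))),
    real_tClosed wt ta_ne_tb, Sym2.eq_swap (a := tc) (b := ta), Sym2.eq_swap (a := tc) (b := tb), wt_ac, wt_bc]
  have hf : (fun i : Cp => (prodBernoulli wt).real (isoPiece (piecePairs ta tb tc part i) tc ta tb)) = fun _ => (cA : ℝ) :=
    funext fun i => piece_c i
  rw [hf, Finset.prod_const, Finset.card_univ, card_Cp]
  ring

/-- **`P(a|b|c) = Q₀^K`.** [this work] -/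
theorem real_sep : (prodBernoulli wt).real
    (((openConn ta tb)ᶜ ∩ (openConn ta tc)ᶜ) ∩ ((openConn ta tb)ᶜ ∩ (openConn tb tc)ᶜ)) = (cQ : ℝ) ^ (2 ^ 64) := by
  rw [real_sepP' wt part ta_ne_tb ta_ne_tc tb_ne_tc badP_null, real_sepP, real_tClosed_inter wt ta_ne_tb ta_ne_tc tb_ne_tc,
    wt_ab, wt_ac, wt_bc]
  have hf : (fun i : Cp => (prodBernoulli wt).real
      (isoPiece (piecePairs ta tb tc part i) ta tb tc ∩ isoPiece (piecePairs ta tb tc part i) tb ta tc)) = fun _ => (cQ : ℝ) :=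
    funext fun i => piece_sep i
  rw [hf, Finset.prod_const, Finset.card_univ, card_Cp]
  ring

/-! ## The refutation -/

/-- **`(3PT)` FAILS for the graph `(VV, wt)` at the terminals `a, b, c`**:
`P(a↔b)·P(a↮b) > P(a↔b, a↮c) + P(a↔c, a↮b) + P(b↔c, a↮b)`. [this work] (prim-l12-p6 gen 22's counterexample family) -/
theorem threePointVariance_fails :
    (prodBernoulli wt).real (openConn ta tb ∩ (openConn ta tc)ᶜ) + (prodBernoulli wt).real (openConn ta tc ∩ (openConn ta tb)ᶜ) +
        (prodBernoulli wt).real (openConn tb tc ∩ (openConn ta tb)ᶜ) <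
      (prodBernoulli wt).real (openConn ta tb) * (prodBernoulli wt).real (openConn ta tb)ᶜ := by
  set μ := prodBernoulli wt with hμ
  set IA : Set (BondConfig VV) := (openConn ta tb)ᶜ ∩ (openConn ta tc)ᶜ with hIA
  set IB : Set (BondConfig VV) := (openConn ta tb)ᶜ ∩ (openConn tb tc)ᶜ with hIB
  set IC : Set (BondConfig VV) := (openConn ta tc)ᶜ ∩ (openConn tb tc)ᶜ with hIC
  -- exact cells
  have hU : (openConn ta tb)ᶜ = IA ∪ IB := by
    ext ω
    simp only [hIA, hIB, mem_union, mem_inter_iff, mem_compl_iff]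
    constructor
    · intro h
      by_cases hac' : ω ∈ openConn ta tc
      · exact Or.inr ⟨h, fun hbc' => h (SimpleGraph.Reachable.trans hac' (SimpleGraph.Reachable.symm hbc'))⟩
      · exact Or.inl ⟨h, hac'⟩
    · rintro (⟨h, -⟩ | ⟨h, -⟩) <;> exact h
  have hS : openConn ta tb ∩ (openConn ta tc)ᶜ = IC \ (IA ∩ IB) := by
    ext ω
    simp only [hIA, hIB, hIC, mem_sdiff, mem_inter_iff, mem_compl_iff]
    constructor
    · rintro ⟨hab, hac⟩
      exact ⟨⟨hac, fun hbc => hac (SimpleGraph.Reachable.trans hab hbc)⟩, fun h => h.1.1 hab⟩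
    · rintro ⟨⟨hac, hbc⟩, hn⟩
      refine ⟨?_, hac⟩
      by_contra hab
      exact hn ⟨⟨hab, hac⟩, hab, hbc⟩
  have hT : openConn ta tc ∩ (openConn ta tb)ᶜ = IB \ (IA ∩ IB) := by
    ext ω
    simp only [hIA, hIB, mem_sdiff, mem_inter_iff, mem_compl_iff]
    constructor
    · rintro ⟨hac, hab⟩
      exact ⟨⟨hab, fun hbc => hab (SimpleGraph.Reachable.trans hac (SimpleGraph.Reachable.symm hbc))⟩, fun h => h.1.2 hac⟩
    · rintro ⟨⟨hab, hbc⟩, hn⟩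
      refine ⟨?_, hab⟩
      by_contra hac
      exact hn ⟨⟨hab, hac⟩, hab, hbc⟩
  have hUu : openConn tb tc ∩ (openConn ta tb)ᶜ = IA \ (IA ∩ IB) := by
    ext ω
    simp only [hIA, hIB, mem_sdiff, mem_inter_iff, mem_compl_iff]
    constructor
    · rintro ⟨hbc, hab⟩
      exact ⟨⟨hab, fun hac => hab (SimpleGraph.Reachable.trans hac (SimpleGraph.Reachable.symm hbc))⟩, fun h => h.2.2 hbc⟩
    · rintro ⟨⟨hab, hac⟩, hn⟩
      refine ⟨?_, hab⟩
      by_contra hbc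
      exact hn ⟨⟨hab, hac⟩, hab, hbc⟩
  have hQC : IA ∩ IB ⊆ IC := fun ω h => ⟨h.1.2, h.2.2⟩
  have hθc : μ.real (openConn ta tb)ᶜ = μ.real IA + μ.real IB - μ.real (IA ∩ IB) := by
    have h := measureReal_union_add_inter (μ := μ) (s := IA) (t := IB) MeasurableSet.of_discrete
    rw [hU]; linarith
  have hθ : μ.real (openConn ta tb) = 1 - μ.real (openConn ta tb)ᶜ := by
    have h := probReal_compl_eq_one_sub (μ := μ) (s := openConn ta tb) MeasurableSet.of_discrete
    linarith
  have hs : μ.real (openConn ta tb ∩ (openConn ta tc)ᶜ) = μ.real IC - μ.real (IA ∩ IB) := by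
    rw [hS]; exact measureReal_sdiff hQC MeasurableSet.of_discrete
  have ht : μ.real (openConn ta tc ∩ (openConn ta tb)ᶜ) = μ.real IB - μ.real (IA ∩ IB) := by
    rw [hT]; exact measureReal_sdiff inter_subset_right MeasurableSet.of_discrete
  have hu : μ.real (openConn tb tc ∩ (openConn ta tb)ᶜ) = μ.real IA - μ.real (IA ∩ IB) := by
    rw [hUu]; exact measureReal_sdiff inter_subset_left MeasurableSet.of_discrete
  -- the four probabilities
  have eC : μ.real IA = (cB : ℝ) ^ (2 ^ 64) := real_IA
  have eB : μ.real IB = (cB : ℝ) ^ (2 ^ 64) := real_IB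
  have eA : μ.real IC = (cA : ℝ) ^ (2 ^ 64) := real_IC
  have eQ : μ.real (IA ∩ IB) = (cQ : ℝ) ^ (2 ^ 64) := real_sep
  rw [hs, ht, hu, hθ, hθc, eC, eB, eA, eQ]
  -- the numbers: Q := Q₀^K, A := A₀^K, B := B₀^K
  have hQpos : (0 : ℝ) < (cQ : ℝ) ^ (2 ^ 64) := pow_pos (by norm_num [cQ]) _
  have hQB : (cQ : ℝ) ^ (2 ^ 64) ≤ (cB : ℝ) ^ (2 ^ 64) :=
    pow_le_pow_left₀ (by norm_num [cQ]) (by norm_num [cQ, cB]) _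
  -- α^K ≤ uA, i.e. A ≤ uA · Q
  have hA : (cA : ℝ) ^ (2 ^ 64) ≤ (uA : ℝ) * (cQ : ℝ) ^ (2 ^ 64) := by
    have h1 : ((cA : ℝ) / cQ) ^ (2 ^ 64) ≤ uA :=
      pow_alpha_le (by norm_num [cA, cQ]) (by norm_num [cA, cQ, αq])
    rw [div_pow, div_le_iff₀ hQpos] at h1
    exact h1
  -- r^K ≤ uR, i.e. B² ≤ uR · Q
  have hB2 : ((cB : ℝ) ^ (2 ^ 64)) ^ 2 ≤ (uR : ℝ) * (cQ : ℝ) ^ (2 ^ 64) := by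
    have h1 : ((cB : ℝ) ^ 2 / cQ) ^ (2 ^ 64) ≤ uR :=
      pow_r_le (by norm_num [cB, cQ]) (by norm_num [cB, cQ, rq])
    rw [div_pow, div_le_iff₀ hQpos, ← pow_mul, mul_comm 2 (2 ^ 64), pow_mul] at h1
    exact h1
  have hgap := gap
  nlinarith [hQpos, hQB, hA, hB2, hgap, sq_nonneg ((cB : ℝ) ^ (2 ^ 64))]

/-- **The three-point variance row `(3PT)` is not valid for all finite weighted graphs**: it fails for `2⁶⁴` parallel copies of the
hub chain `G₄(1/150,1/150)` glued at the three terminals (`threePointVariance_fails`). [this work] (counterexample family of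
prim-l12-p6 gen 22, memo `prim-l12/FROM-prim-l12-p6-g22-3PT-REFUTED.md`) -/
theorem not_threePointVariance_all :
    ¬ ∀ (V : Type) [Fintype V] [DecidableEq V] (w : Sym2 V → unitInterval) (a b c : V), a ≠ b → a ≠ c → b ≠ c →
      (prodBernoulli w).real (openConn a b) * (prodBernoulli w).real (openConn a b)ᶜ ≤
        (prodBernoulli w).real (openConn a b ∩ (openConn a c)ᶜ) + (prodBernoulli w).real (openConn a c ∩ (openConn a b)ᶜ) +
          (prodBernoulli w).real (openConn b c ∩ (openConn a b)ᶜ) := by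
  intro h
  exact absurd (h VV wt ta tb tc ta_ne_tb ta_ne_tc tb_ne_tc) (not_le.2 threePointVariance_fails)

end Summit.CriticalPhenomena.PercolationContinuityZ3.Theorems.ThreePointVarianceRefutation
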